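import Mathlib.Computability.DFA
import Mathlib.Algebra.BigOperators.Fin
import Mathlib.Algebra.BigOperators.Ring.Finset
import Mathlib.Logic.Equiv.Fin.Basic
import Literature.Computability.AutomaticStructures.AutomaticBlock
import HarnessLib

/-!
# Digit-track path counts of a synchronous two-track automaton

Trunk Literature/Computability/AutomaticStructures (route MatrixMultiplication/AutomaticSTPPDesigns,
crux `RegularTowerGap`, stmt-MatrixMultiplication-7358). A DFA `M` over the pair alphabet
`ι × Fin p` reads an INDEX word `w ∈ ι^k` on the first track and a base-`p` DIGIT word
`a ∈ (Fin p)^k` on the second. For states `s, s'` the **path count**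

  `pathCount M s s' k w = #{a ∈ (Fin p)^k : M.evalFrom s ((w₀,a₀)(w₁,a₁)⋯(w_{k-1},a_{k-1})) = s'}`

is the `(s, s')` entry of the product `T(w₀) T(w₁) ⋯ T(w_{k-1})` of the nonnegative integer
"digit transfer matrices" `T(i)[s, s'] = #{d ∈ Fin p : M.step s (i, d) = s'}` — the transfer-matrix
method for counting paths in a finite automaton (Schützenberger 1961; Chomsky–Schützenberger 1963:
the number of accepted words of each length of a regular language is a coefficient of an ℕ-rational
series; Berstel–Reutenauer, *Noncommutative Rational Series with Applications*, CUP 2010, Ch. 1).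
This file provides the two facts the crux uses:

* `pathCount_append` — MULTIPLICATIVITY (the matrix product):
  `pathCount M s s'' (k+l) (Fin.append u v) = ∑ s', pathCount M s s' k u * pathCount M s' s'' l v`;
  `pathCount_zero` (the identity matrix at length `0`), `pathCount_pos_iff`, `pathCount_le`;
* `card_automaticBlock_eq_sum_pathCount` — the block `A_w` of the automatic family of `M.accepts`
  (file `AutomaticBlock.lean`) has `|A_w| = ∑_{s' accepting} pathCount M start s' k w`;
* `card_pathBlock`, `pathBlock_subset_automaticBlock` — for a reaching prefix `(u, α)` into `s`
  and an accepting suffix `(v, β)` out of `s'`, the digit words counted by `pathCount M s s' k w`,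
  framed as `α a β` and read as values in `ℤ/(p^(m+k+n))`, form a SUB-block of the genuine block
  `A_{u w v}` of the same cardinality (this is how state-to-state counts re-enter STPP families).

## References

* M.-P. Schützenberger, *On the definition of a family of automata*, Inf. Control 4 (1961) 245–270.
* J. Berstel, C. Reutenauer, *Noncommutative Rational Series with Applications*, CUP 2010, Ch. 1
  (recognizable series, linear representations `(λ, μ, γ)`: the coefficient of `w` is `λ μ(w) γ`).
* V. Bruyère, G. Hansel, C. Michaux, R. Villemaire, Bull. Belg. Math. Soc. 1 (1994), §5.1
  (synchronous `p`-automata), as in `AutomaticBlock.lean`.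
-/

noncomputable section

open Finset

open scoped Classical

namespace Literature.Computability.AutomaticStructures

variable {ι : Type*} {p : ℕ} {σ : Type*}

/-! ### Path counts -/

/-- **Digit-track path count.** For a DFA `M` over `ι × Fin p`, states `s s'`, and an index word
`w : Fin k → ι`: the number of digit words `a : Fin k → Fin p` such that reading the zipped word
`((w 0, a 0), …, (w (k-1), a (k-1)))` from `s` ends in `s'`. Equivalently the `(s, s')` entry of the
product of the digit transfer matrices along `w` (Berstel–Reutenauer 2010, Ch. 1: `μ(w)_{s,s'}`).
[folklore] -/
def pathCount (M : DFA (ι × Fin p) σ) (s s' : σ) (k : ℕ) (w : Fin k → ι) : ℕ :=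
  ((Finset.univ : Finset (Fin k → Fin p)).filter
    (fun a => M.evalFrom s (List.ofFn fun j : Fin k => (w j, a j)) = s')).card

variable (M : DFA (ι × Fin p) σ)

/-- Unfolding `pathCount`. [folklore] -/
theorem pathCount_def (s s' : σ) (k : ℕ) (w : Fin k → ι) :
    pathCount M s s' k w =
      ((Finset.univ : Finset (Fin k → Fin p)).filter
        (fun a => M.evalFrom s (List.ofFn fun j : Fin k => (w j, a j)) = s')).card :=
  rfl

/-- `pathCount M s s' k w` is positive iff some digit word drives `s` to `s'` along `w`. [folklore] -/
theorem pathCount_pos_iff {s s' : σ} {k : ℕ} {w : Fin k → ι} :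
    0 < pathCount M s s' k w ↔
      ∃ a : Fin k → Fin p, M.evalFrom s (List.ofFn fun j : Fin k => (w j, a j)) = s' := by
  rw [pathCount, Finset.card_pos]
  constructor
  · rintro ⟨a, ha⟩
    exact ⟨a, (Finset.mem_filter.1 ha).2⟩
  · rintro ⟨a, ha⟩
    exact ⟨a, Finset.mem_filter.2 ⟨Finset.mem_univ _, ha⟩⟩

/-- `pathCount M s s' k w ≠ 0` iff some digit word drives `s` to `s'` along `w`. [folklore] -/
theorem pathCount_ne_zero_iff {s s' : σ} {k : ℕ} {w : Fin k → ι} :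
    pathCount M s s' k w ≠ 0 ↔
      ∃ a : Fin k → Fin p, M.evalFrom s (List.ofFn fun j : Fin k => (w j, a j)) = s' := by
  rw [← pathCount_pos_iff, Nat.pos_iff_ne_zero]

/-- The trivial bound `pathCount ≤ p^k` (there are `p^k` digit words). [folklore] -/
theorem pathCount_le (s s' : σ) (k : ℕ) (w : Fin k → ι) : pathCount M s s' k w ≤ p ^ k := by
  rw [pathCount]
  calc _ ≤ (Finset.univ : Finset (Fin k → Fin p)).card := Finset.card_filter_le _ _
    _ = p ^ k := by simp

/-- At length `0` the path-count matrix is the identity. [folklore] -/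
theorem pathCount_zero (s s' : σ) (w : Fin 0 → ι) :
    pathCount M s s' 0 w = if s = s' then 1 else 0 := by
  rw [pathCount]
  by_cases h : s = s'
  · rw [if_pos h]
    rw [Finset.card_eq_one]
    refine ⟨fun j => j.elim0, ?_⟩
    ext a
    simp only [Finset.mem_filter, Finset.mem_univ, true_and, Finset.mem_singleton, List.ofFn_zero,
      DFA.evalFrom_nil, h, true_iff]
    funext j; exact j.elim0
  · rw [if_neg h, Finset.card_eq_zero, Finset.filter_eq_empty_iff]
    intro a _
    simpa only [List.ofFn_zero, DFA.evalFrom_nil] using h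

/-- Zipping commutes with `Fin.append`: the two-track word of `(Fin.append u v, Fin.append α β)` is
`Fin.append` of the two-track words. [folklore] -/
theorem zip_append {k l : ℕ} (u : Fin k → ι) (v : Fin l → ι) (α : Fin k → Fin p)
    (β : Fin l → Fin p) :
    (fun j : Fin (k + l) => (Fin.append u v j, Fin.append α β j)) =
      Fin.append (fun j => (u j, α j)) (fun j => (v j, β j)) := by
  funext j
  refine Fin.addCases (fun i => ?_) (fun i => ?_) j
  · simp only [Fin.append_left]
  · simp only [Fin.append_right]

/-- Reading `(Fin.append u v, Fin.append α β)` = reading `(u, α)` then `(v, β)`. [folklore] -/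
theorem evalFrom_append (s : σ) {k l : ℕ} (u : Fin k → ι) (v : Fin l → ι) (α : Fin k → Fin p)
    (β : Fin l → Fin p) :
    M.evalFrom s (List.ofFn fun j : Fin (k + l) => (Fin.append u v j, Fin.append α β j)) =
      M.evalFrom (M.evalFrom s (List.ofFn fun j : Fin k => (u j, α j)))
        (List.ofFn fun j : Fin l => (v j, β j)) := by
  rw [zip_append, List.ofFn_fin_append, DFA.evalFrom_of_append]

/-- **Multiplicativity of path counts** (the transfer-matrix product, Berstel–Reutenauer 2010,
Ch. 1: `μ(uv) = μ(u) μ(v)`): along a concatenated index word `Fin.append u v`, the digit words from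
`s` to `s''` are counted by summing over the intermediate state `s'` reached after `u`.
[folklore] -/
theorem pathCount_append (s s'' : σ) {k l : ℕ} (u : Fin k → ι) (v : Fin l → ι) [Fintype σ] :
    pathCount M s s'' (k + l) (Fin.append u v) =
      ∑ s', pathCount M s s' k u * pathCount M s' s'' l v := by
  -- the digit words for `(u, ·)` ending in `s'`, and for `(v, ·)` from `s'` to `s''`
  set X : σ → Finset (Fin k → Fin p) := fun s' =>
    (Finset.univ : Finset (Fin k → Fin p)).filter
      (fun a => M.evalFrom s (List.ofFn fun j : Fin k => (u j, a j)) = s') with hX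
  set Y : σ → Finset (Fin l → Fin p) := fun s' =>
    (Finset.univ : Finset (Fin l → Fin p)).filter
      (fun b => M.evalFrom s' (List.ofFn fun j : Fin l => (v j, b j)) = s'') with hY
  -- the set counted on the left, pulled back along `Fin.appendEquiv`
  set Z : Finset ((Fin k → Fin p) × (Fin l → Fin p)) :=
    (Finset.univ : Finset ((Fin k → Fin p) × (Fin l → Fin p))).filter
      (fun ab => M.evalFrom (M.evalFrom s (List.ofFn fun j : Fin k => (u j, ab.1 j)))
        (List.ofFn fun j : Fin l => (v j, ab.2 j)) = s'') with hZ
  have hleft : pathCount M s s'' (k + l) (Fin.append u v) = Z.card := by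
    rw [pathCount]
    refine Finset.card_bij' (fun c _ => (Fin.appendEquiv k l).symm c)
      (fun ab _ => Fin.appendEquiv k l ab) (fun c hc => ?_) (fun ab hab => ?_)
      (fun c _ => Equiv.apply_symm_apply _ _) (fun ab _ => Equiv.symm_apply_apply _ _)
    · rw [Finset.mem_filter] at hc ⊢
      refine ⟨Finset.mem_univ _, ?_⟩
      have h := hc.2
      conv_lhs at h => rw [← (Fin.appendEquiv k l).apply_symm_apply c]
      simp only [Fin.appendEquiv_apply] at h
      rwa [evalFrom_append] at h
    · rw [Finset.mem_filter] at hab ⊢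
      refine ⟨Finset.mem_univ _, ?_⟩
      simp only [Fin.appendEquiv_apply]
      rw [evalFrom_append]
      exact hab.2
  -- `Z` is the disjoint union over `s'` of `X s' × Y s'`
  have hZeq : Z = (Finset.univ : Finset σ).biUnion fun s' => X s' ×ˢ Y s' := by
    ext ⟨a, b⟩
    simp only [hZ, hX, hY, Finset.mem_filter, Finset.mem_univ, true_and, Finset.mem_biUnion,
      Finset.mem_product, exists_eq_left']
  have hdisj : (↑(Finset.univ : Finset σ) : Set σ).PairwiseDisjoint fun s' => X s' ×ˢ Y s' := by
    intro s₁ _ s₂ _ hne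
    rw [Function.onFun, Finset.disjoint_left]
    rintro ⟨a, b⟩ h1 h2
    rw [Finset.mem_product] at h1 h2
    have e1 := (Finset.mem_filter.1 h1.1).2
    have e2 := (Finset.mem_filter.1 h2.1).2
    exact hne (e1.symm.trans e2)
  rw [hleft, hZeq, Finset.card_biUnion hdisj]
  refine Finset.sum_congr rfl fun s' _ => ?_
  rw [Finset.card_product]
  rfl

/-! ### Blocks and path counts -/

/-- **`|A_w| = ∑_{s' accepting} pathCount M start s' k w`**: the block of the automatic family of
`M.accepts` at the index word `w` is counted by the accepting entries of the start row of the
path-count matrix (Berstel–Reutenauer 2010, Ch. 1: the number of accepted words is `λ μ(w) γ`).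
[folklore] -/
theorem card_automaticBlock_eq_sum_pathCount [Fintype σ] (k : ℕ) (w : Fin k → ι) :
    (automaticBlock p k M.accepts w).card =
      ∑ s' ∈ (Finset.univ : Finset σ).filter (fun s' => s' ∈ M.accept),
        pathCount M M.start s' k w := by
  rw [card_automaticBlock]
  have hmaps : ((↑((Finset.univ : Finset (Fin k → Fin p)).filter
      (fun a => List.ofFn (fun j : Fin k => (w j, a j)) ∈ M.accepts)) : Set (Fin k → Fin p))).MapsTo
      (fun a => M.evalFrom M.start (List.ofFn fun j : Fin k => (w j, a j)))
      ↑((Finset.univ : Finset σ).filter (fun s' => s' ∈ M.accept)) := by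
    intro a ha
    rw [Finset.mem_coe, Finset.mem_filter] at ha ⊢
    exact ⟨Finset.mem_univ _, ha.2⟩
  rw [Finset.card_eq_sum_card_fiberwise hmaps]
  refine Finset.sum_congr rfl fun s' hs' => ?_
  rw [pathCount]
  congr 1
  ext a
  simp only [Finset.mem_filter, Finset.mem_univ, true_and]
  constructor
  · rintro ⟨-, h⟩; exact h
  · intro h
    refine ⟨?_, h⟩
    rw [DFA.mem_accepts]
    change M.evalFrom M.start _ ∈ M.accept
    rw [h]
    exact (Finset.mem_filter.1 hs').2

/-! ### Framed digit words: state-to-state counts as sub-blocks of genuine blocks -/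

/-- The **path block**: the values in `ℤ/(p^(m+k+n))` of the framed digit words `α a β`, where `a`
ranges over the digit words driving `s` to `s'` along `w` and the frame `(α, β)` is fixed. (Used
with `α` a reaching prefix and `β` an accepting suffix, `pathBlock_subset_automaticBlock`.)
[folklore] -/
def pathBlock (s s' : σ) {m k n : ℕ} (α : Fin m → Fin p) (w : Fin k → ι) (β : Fin n → Fin p) :
    Finset (ZMod (p ^ (m + k + n))) :=
  (((Finset.univ : Finset (Fin k → Fin p)).filter
    (fun a => M.evalFrom s (List.ofFn fun j : Fin k => (w j, a j)) = s')).image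
    fun a => (digitValue (Fin.append (Fin.append α a) β) : ZMod (p ^ (m + k + n))))

/-- Framing is injective: `a ↦ α a β` is injective. [folklore] -/
theorem frame_injective {m k n : ℕ} (α : Fin m → Fin p) (β : Fin n → Fin p) :
    Function.Injective fun a : Fin k → Fin p => Fin.append (Fin.append α a) β := by
  intro a b h
  have h1 : Fin.append α a = Fin.append α b := by
    have := congrArg (fun c => ((Fin.appendEquiv (m + k) n).symm c).1) h
    simpa only [Fin.appendEquiv, Equiv.coe_fn_symm_mk, Fin.append_left] using this
  have := congrArg (fun c => ((Fin.appendEquiv m k).symm c).2) h1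
  simpa only [Fin.appendEquiv, Equiv.coe_fn_symm_mk, Fin.append_right] using this

/-- **The path block has cardinality the path count** (framing and the value map are injective).
[folklore] -/
theorem card_pathBlock (s s' : σ) {m k n : ℕ} (α : Fin m → Fin p) (w : Fin k → ι)
    (β : Fin n → Fin p) :
    (pathBlock M s s' α w β).card = pathCount M s s' k w := by
  rw [pathBlock, pathCount, Finset.card_image_of_injective]
  exact (natCast_digitValue_injective p (m + k + n)).comp (frame_injective α β)

/-- **The path block is a sub-block of a genuine block.** If `(u, α)` drives `M.start` to `s` and
`(v, β)` drives `s'` into `M.accept`, then every framed word `α a β` with `a` counted by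
`pathCount M s s' k w` is accepted along the index word `u w v`, so
`pathBlock M s s' α w β ⊆ A_{u w v}` (the block of `M.accepts` at scale `m + k + n`). [folklore] -/
theorem pathBlock_subset_automaticBlock (s s' : σ) {m k n : ℕ} {u : Fin m → ι} {α : Fin m → Fin p}
    (hu : M.evalFrom M.start (List.ofFn fun j : Fin m => (u j, α j)) = s) (w : Fin k → ι)
    {v : Fin n → ι} {β : Fin n → Fin p}
    (hv : M.evalFrom s' (List.ofFn fun j : Fin n => (v j, β j)) ∈ M.accept) :
    pathBlock M s s' α w β ⊆
      automaticBlock p (m + k + n) M.accepts (Fin.append (Fin.append u w) v) := by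
  intro x hx
  rw [pathBlock, Finset.mem_image] at hx
  obtain ⟨a, ha, rfl⟩ := hx
  rw [Finset.mem_filter] at ha
  rw [natCast_digitValue_mem_automaticBlock, DFA.mem_accepts]
  change M.evalFrom M.start _ ∈ M.accept
  rw [evalFrom_append, evalFrom_append, hu, ha.2]
  exact hv

end Literature.Computability.AutomaticStructures
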